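import Summits.KontsevichZagierPeriods.Zeta5Search.LaiSweepShard

/-!
# `κ₃` sweep certificate — shard file 077 of 127 (shards 539–545 of 889)

HONEST FRAMING. Systematic search; no irrationality claim unless certified. This file only checks,
by `decide +kernel`, shards 539–545 of the order-cell sweep of the `κ₃` point `(74, 2180, 444; δ74)`
(engine `LaiSweepEngine`, soundness `LaiSweepJump/Free/Eval/Shard/Kappa3`; a shard is `⟨regime, n,
p, q, p', q', Lo, Up⟩`: `n` cells from `p/q` to `p'/q'` with integer rate sums in `[Lo, Up]`, `K =
128`, `D = 2^40`). It draws NO conclusion: only the capstone `LaiKappa3SweepCert`, which needs all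
127 shard files, does. Kernel cost of this file ≈ 560 cells × 0.3 s.
-/

namespace Summit.KontsevichZagierPeriods.Zeta5Search.Sweep

set_option maxHeartbeats 100000000 in
/-- Shard 539: 80 cells of regime B from `205/366` to `229/408`.
[cite: Lai2024BallRivoal, §4 Lemma 4.3] -/
theorem shard539 :
    Shard.check 128 (2^40)
      ⟨true, 80, 205, 366, 229, 408, 12874255355867, 16428734455947⟩ = true := by
  decide +kernel

set_option maxHeartbeats 100000000 in
/-- Shard 540: 80 cells of regime B from `229/408` to `2703/4804`.
[cite: Lai2024BallRivoal, §4 Lemma 4.3] -/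
theorem shard540 :
    Shard.check 128 (2^40)
      ⟨true, 80, 229, 408, 2703, 4804, 15233877861014, 19459761504898⟩ = true := by
  decide +kernel

set_option maxHeartbeats 100000000 in
/-- Shard 541: 80 cells of regime B from `2703/4804` to `243/431`.
[cite: Lai2024BallRivoal, §4 Lemma 4.3] -/
theorem shard541 :
    Shard.check 128 (2^40)
      ⟨true, 80, 2703, 4804, 243, 431, 12646950331480, 16171047118326⟩ = true := by
  decide +kernel

set_option maxHeartbeats 100000000 in
/-- Shard 542: 80 cells of regime B from `243/431` to `152/269`.
[cite: Lai2024BallRivoal, §4 Lemma 4.3] -/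
theorem shard542 :
    Shard.check 128 (2^40)
      ⟨true, 80, 243, 431, 152, 269, 13753693812772, 17602926220452⟩ = true := by
  decide +kernel

set_option maxHeartbeats 100000000 in
/-- Shard 543: 80 cells of regime B from `152/269` to `239/422`.
[cite: Lai2024BallRivoal, §4 Lemma 4.3] -/
theorem shard543 :
    Shard.check 128 (2^40)
      ⟨true, 80, 152, 269, 239, 422, 14215410898019, 18212325099068⟩ = true := by
  decide +kernel

set_option maxHeartbeats 100000000 in
/-- Shard 544: 80 cells of regime B from `239/422` to `214/377`.
[cite: Lai2024BallRivoal, §4 Lemma 4.3] -/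
theorem shard544 :
    Shard.check 128 (2^40)
      ⟨true, 80, 239, 422, 214, 377, 14126513960023, 18116941417483⟩ = true := by
  decide +kernel

set_option maxHeartbeats 100000000 in
/-- Shard 545: 80 cells of regime B from `214/377` to `95/167`.
[cite: Lai2024BallRivoal, §4 Lemma 4.3] -/
theorem shard545 :
    Shard.check 128 (2^40)
      ⟨true, 80, 214, 377, 95, 167, 13388514001966, 17187489277351⟩ = true := by
  decide +kernel

/-- The checked shards of this file, in order. [folklore] -/
def shards077 : List (CheckedShard 128 (2^40)) :=
  [⟨_, shard539⟩, ⟨_, shard540⟩, ⟨_, shard541⟩, ⟨_, shard542⟩, ⟨_, shard543⟩,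
    ⟨_, shard544⟩, ⟨_, shard545⟩]

end Summit.KontsevichZagierPeriods.Zeta5Search.Sweep
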